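import Mathlib
import HarnessLib
import Literature.Analysis.FluidPDE.ClassicalSolution
import Literature.Analysis.FluidPDE.ClassicalSolutionCalculus
import Literature.Analysis.FluidPDE.SpaceTimeCalculus
import Literature.Analysis.FluidPDE.LerayProfileCalculus
import Literature.Analysis.FluidPDE.SelfSimilar
import Literature.Analysis.FluidPDE.EnstrophyGronwall
import Literature.Analysis.FluidPDE.KNSSThm52Integrand

/-!
# Route `LocalPressureProfileDoor`, crux K2⁺ `MonotonePressureProfileRigidity` (stmt-NavierStokesRegularity-20180),
# line `birth`, stub `stub_smallSliceOfMonotonePressure` — helper 2/4: the HEAD test field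
# `q_E(t,x) = ½(−t)‖v(t,x)‖² + ½⟪x, v(t,x)⟫` in physical variables

Cell ns-regularity-ideate, seat ns-pressure-K2-p1 (LEAD; helper file, lands `--supports stmt-NavierStokesRegularity-20180`).

In Leray's similarity variables `U(s,y) = √(−t) v(t, √(−t)y)` the kinematic part of the head pressure of the line's card is
`E = ½|U|² + ½⟪y, U⟫`; read at the physical point `x = √(−t) y` this is the field `q_E(t,x) = ½(−t)‖v‖² + ½⟪x, v⟫` of this
file.  For a classical solution `(v, p)` of Navier–Stokes (`ν = 1`, `f = 0`) on an open time set: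

* `hasDerivAt_headField_time`, `fderiv_headField_apply`, `laplacian_headField` — the three derivatives (the field is passed
  as `q` with the definitional hypothesis `hq : q t x = ½(−t)‖v t x‖² + ½⟪x, v t x⟫`, so that no definition is introduced);
* `headField_density` — the EXACT pointwise identity
  `∂ₜq_E + v·∇q_E − Δq_E = −(−t)|∇v|²_F − ∇p·((−t)v + ½x)`
  (the momentum equation paired with `(−t)v + ½x`; `Δ‖v‖² = 2⟪Δv,v⟫ + 2|∇v|²`, `Δ⟪x,v⟫ = ⟪x,Δv⟫ + 2 div v`, `div v = 0`) —
  the physical form of the similarity head identity `(∂ₛ + L)E + LP = −|Ω|²` up to the pressure Laplacian, which the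
  companion frozen-slice field supplies;
* `isSmoothSpaceTimeOn_headField` — joint smoothness;
* `headField_window_bounds` — on a window `(a,b)`, `−1 ≤ a < b < 0`, uniform bounds on `q_E, ∇q_E, Δq_E, ∂ₜq_E` from the
  scale-invariant apex bounds `‖v‖ ≤ C/(‖x‖+√(−t))`, `‖∇v‖ ≤ L/(‖x‖+√(−t))²`, `‖D²v‖, ‖∂ₜv‖ ≤ L/(‖x‖+√(−t))³`
  (the hypotheses of the tree's first variation `hasDerivAt_integral_mul_kernel_of_bounds`);
* `abs_headField_le` — the global bound `|q_E| ≤ ½C² + ½C` (the `sup|Π|` of the budget).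

WHAT THIS IS NOT: not a claim about Navier–Stokes regularity; calculus for the budget of the L stub
(bears_on LADDER-NS N0, rung N0-LocalTubeDoorPressureProfile).
-/

noncomputable section

set_option linter.dupNamespace false -- the summit and its sub-problem share the name (CONVENTIONS §1)
set_option maxSynthPendingDepth 3 -- nested operator types `ℝ³ →L[ℝ] ℝ³ →L[ℝ] ℝ³`

namespace Summit.NavierStokesRegularity.NavierStokesRegularity.Theorems.LocalPressureProfileDoorMonotonePressureProfileRigiditySmallSliceHead

open MeasureTheory Set Function Filter Metric Topology InnerProductSpace
open scoped ENNReal NNReal InnerProductSpace RealInnerProductSpace Laplacian ContDiff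
open Literature.Analysis Literature.Analysis.FluidPDE

/-! ### The head test field and its derivatives -/

/-- **Joint smoothness of the head test field** on any time set where `v` is jointly smooth. [folklore] -/
theorem isSmoothSpaceTimeOn_headField {S : Set ℝ} {v : ℝ → EuclideanSpace ℝ (Fin 3) → EuclideanSpace ℝ (Fin 3)}
    (hv : IsSmoothSpaceTimeOn S v) {q : ℝ → EuclideanSpace ℝ (Fin 3) → ℝ}
    (hq : ∀ t x, q t x = (-t) / 2 * ‖v t x‖ ^ 2 + 1 / 2 * ⟪x, v t x⟫) :
    IsSmoothSpaceTimeOn S q := by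
  have e : uncurry q =
      fun z : ℝ × EuclideanSpace ℝ (Fin 3) => (-z.1) / 2 * ‖uncurry v z‖ ^ 2 + 1 / 2 * ⟪z.2, uncurry v z⟫ := by
    funext z; rcases z with ⟨t, x⟩; exact hq t x
  show ContDiffOn ℝ ∞ (uncurry q) (S ×ˢ univ)
  rw [e]
  exact ((contDiffOn_fst.neg.div_const 2).mul (hv.norm_sq ℝ)).add
    (contDiffOn_const.mul (contDiffOn_snd.inner ℝ hv))

/-- **The time derivative of the head field**: if `s ↦ v(s, x)` has derivative `A` at `t`, then
`∂ₜq_E(t,x) = −½‖v‖² + (−t)⟪v, A⟫ + ½⟪x, A⟫`. [folklore] -/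
theorem hasDerivAt_headField_time {v : ℝ → EuclideanSpace ℝ (Fin 3) → EuclideanSpace ℝ (Fin 3)}
    {q : ℝ → EuclideanSpace ℝ (Fin 3) → ℝ}
    (hq : ∀ t x, q t x = (-t) / 2 * ‖v t x‖ ^ 2 + 1 / 2 * ⟪x, v t x⟫) {t : ℝ} {x A : EuclideanSpace ℝ (Fin 3)}
    (hline : HasDerivAt (fun s => v s x) A t) :
    HasDerivAt (fun s => q s x)
      (-(1 / 2) * ‖v t x‖ ^ 2 + (-t) * ⟪v t x, A⟫ + 1 / 2 * ⟪x, A⟫) t := by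
  have ha : HasDerivAt (fun s : ℝ => (-s) / 2) (-(1 / 2) : ℝ) t :=
    ((hasDerivAt_id t).neg.div_const 2).congr_deriv (by norm_num)
  have hn : HasDerivAt (fun s => ‖v s x‖ ^ 2) (2 * ⟪v t x, A⟫) t := hline.norm_sq
  have hm : HasDerivAt (fun s => ⟪x, v s x⟫) (⟪x, A⟫ + ⟪(0 : EuclideanSpace ℝ (Fin 3)), v t x⟫) t :=
    (hasDerivAt_const t x).inner ℝ hline
  have e : (fun s => q s x) = fun s => (-s) / 2 * ‖v s x‖ ^ 2 + 1 / 2 * ⟪x, v s x⟫ := funext fun s => hq s x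
  have h : HasDerivAt (fun s => (-s) / 2 * ‖v s x‖ ^ 2 + 1 / 2 * ⟪x, v s x⟫)
      (-(1 / 2) * ‖v t x‖ ^ 2 + (-t) / 2 * (2 * ⟪v t x, A⟫) + 1 / 2 * (⟪x, A⟫ + ⟪(0 : EuclideanSpace ℝ (Fin 3)), v t x⟫)) t :=
    (ha.mul hn).add (hm.const_mul (1 / 2))
  rw [e]
  refine h.congr_deriv ?_
  rw [inner_zero_left, add_zero]
  ring

/-- **The space derivative of the head field**: for `v(t)` differentiable at `x` with `Dv = D(v t)(x)`,
`Dq_E(t)(x) w = (−t)⟪v, Dv w⟫ + ½⟪w, v⟫ + ½⟪x, Dv w⟫`. [folklore] -/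
theorem fderiv_headField_apply {v : ℝ → EuclideanSpace ℝ (Fin 3) → EuclideanSpace ℝ (Fin 3)}
    {q : ℝ → EuclideanSpace ℝ (Fin 3) → ℝ}
    (hq : ∀ t x, q t x = (-t) / 2 * ‖v t x‖ ^ 2 + 1 / 2 * ⟪x, v t x⟫) {t : ℝ} {x : EuclideanSpace ℝ (Fin 3)}
    (hv : DifferentiableAt ℝ (v t) x) (w : EuclideanSpace ℝ (Fin 3)) :
    fderiv ℝ (q t) x w =
      (-t) * ⟪v t x, fderiv ℝ (v t) x w⟫ + 1 / 2 * ⟪w, v t x⟫ + 1 / 2 * ⟪x, fderiv ℝ (v t) x w⟫ := by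
  have hn : HasFDerivAt (fun y => ‖v t y‖ ^ 2) (2 • (innerSL ℝ (v t x)).comp (fderiv ℝ (v t) x)) x :=
    hv.hasFDerivAt.norm_sq
  have hm : HasFDerivAt (fun y : EuclideanSpace ℝ (Fin 3) => ⟪y, v t y⟫)
      ((fderivInnerCLM ℝ ((x, v t x) : EuclideanSpace ℝ (Fin 3) × EuclideanSpace ℝ (Fin 3))).comp
        ((ContinuousLinearMap.id ℝ (EuclideanSpace ℝ (Fin 3))).prod (fderiv ℝ (v t) x))) x :=
    (hasFDerivAt_id x).inner ℝ hv.hasFDerivAt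
  have e : q t = fun y => (-t) / 2 * ‖v t y‖ ^ 2 + 1 / 2 * ⟪y, v t y⟫ := funext fun y => hq t y
  have h : HasFDerivAt (fun y => (-t) / 2 * ‖v t y‖ ^ 2 + 1 / 2 * ⟪y, v t y⟫)
      (((-t) / 2) • (2 • (innerSL ℝ (v t x)).comp (fderiv ℝ (v t) x)) +
        (1 / 2 : ℝ) • ((fderivInnerCLM ℝ ((x, v t x) : EuclideanSpace ℝ (Fin 3) × EuclideanSpace ℝ (Fin 3))).comp
          ((ContinuousLinearMap.id ℝ (EuclideanSpace ℝ (Fin 3))).prod (fderiv ℝ (v t) x)))) x :=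
    (hn.const_mul ((-t) / 2)).add (hm.const_mul (1 / 2))
  rw [e, h.fderiv]
  simp only [_root_.add_apply, FunLike.coe_smul, Pi.smul_apply,
    ContinuousLinearMap.coe_comp, Function.comp_apply, innerSL_apply_apply, fderivInnerCLM_apply,
    ContinuousLinearMap.prod_apply, ContinuousLinearMap.coe_id', id_eq, smul_eq_mul]
  ring

/-- **The Laplacian of the head field**: for `v(t) ∈ C²`,
`Δq_E(t)(x) = (−t)(⟪Δv, v⟫ + |Dv|²_F) + ½⟪x, Δv⟫ + div v(t)(x)` (`laplacian_inner_self_eq`, `laplacian_inner_id_eq`).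
[folklore] -/
theorem laplacian_headField {v : ℝ → EuclideanSpace ℝ (Fin 3) → EuclideanSpace ℝ (Fin 3)}
    {q : ℝ → EuclideanSpace ℝ (Fin 3) → ℝ}
    (hq : ∀ t x, q t x = (-t) / 2 * ‖v t x‖ ^ 2 + 1 / 2 * ⟪x, v t x⟫) {t : ℝ} (hv : ContDiff ℝ 2 (v t)) (x : EuclideanSpace ℝ (Fin 3)) :
    (Δ (q t)) x =
      (-t) * (⟪(Δ (v t)) x, v t x⟫ + frobeniusNormSq (fderiv ℝ (v t) x)) + 1 / 2 * ⟪x, (Δ (v t)) x⟫ +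
        VectorCalculus.divergence (v t) x := by
  have hn2 : ContDiff ℝ 2 (fun y => ‖v t y‖ ^ 2) := hv.norm_sq ℝ
  have hm2 : ContDiff ℝ 2 (fun y : EuclideanSpace ℝ (Fin 3) => ⟪y, v t y⟫) := contDiff_id.inner ℝ hv
  have e : q t =
      ((-t) / 2) • (fun y => ‖v t y‖ ^ 2) + (1 / 2 : ℝ) • (fun y : EuclideanSpace ℝ (Fin 3) => ⟪y, v t y⟫) := by
    funext y; simp only [hq, Pi.add_apply, Pi.smul_apply, smul_eq_mul]
  have hfun : (fun y => ‖v t y‖ ^ 2) = fun y => ⟪v t y, v t y⟫ := by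
    funext y; rw [real_inner_self_eq_norm_sq]
  have hA : ContDiffAt ℝ 2 (((-t) / 2) • fun y => ‖v t y‖ ^ 2) x := (hn2.const_smul ((-t) / 2)).contDiffAt
  have hB : ContDiffAt ℝ 2 ((1 / 2 : ℝ) • fun y : EuclideanSpace ℝ (Fin 3) => ⟪y, v t y⟫) x := (hm2.const_smul (1 / 2 : ℝ)).contDiffAt
  rw [e, hA.laplacian_add hB, InnerProductSpace.laplacian_smul _ hn2.contDiffAt,
    InnerProductSpace.laplacian_smul _ hm2.contDiffAt, smul_eq_mul, smul_eq_mul, hfun,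
    laplacian_inner_self_eq hv x, laplacian_inner_id_eq hv x]
  ring

/-! ### The density identity -/

/-- **The head density identity.**  For a classical solution `(v, p)` of Navier–Stokes (`ν = 1`, `f = 0`) on an open time
set `S`, at `t ∈ S` and every `x`:
`∂ₜq_E + Dq_E(v) − Δq_E = −(−t)|Dv|²_F − Dp((−t)v + ½x)` for `q_E = ½(−t)‖v‖² + ½⟪x,v⟫`:
the three derivatives above, `div v = 0`, and the momentum equation `∂ₜv + Dv v − Δv = −∇p` paired with
`(−t)v + ½x`. [cite: Tsai1998, (1.7) and proof of Lemma 3.1 (p. 37)] -/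
theorem headField_density {S : Set ℝ} {v : ℝ → EuclideanSpace ℝ (Fin 3) → EuclideanSpace ℝ (Fin 3)} {p : ℝ → EuclideanSpace ℝ (Fin 3) → ℝ}
    (hcl : IsClassicalNSSolutionOn S 1 0 v p) (hS : IsOpen S) {q : ℝ → EuclideanSpace ℝ (Fin 3) → ℝ}
    (hq : ∀ t x, q t x = (-t) / 2 * ‖v t x‖ ^ 2 + 1 / 2 * ⟪x, v t x⟫)
    {t : ℝ} (ht : t ∈ S) (x : EuclideanSpace ℝ (Fin 3)) :
    deriv (fun s => q s x) t + fderiv ℝ (q t) x (v t x) - (Δ (q t)) x =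
      -((-t) * frobeniusNormSq (fderiv ℝ (v t) x)) -
        fderiv ℝ (p t) x ((-t) • v t x + (1 / 2 : ℝ) • x) := by
  have hu2 : ContDiff ℝ 2 (v t) := (hcl.contDiff_velocity ht).of_le (by norm_cast)
  have hud : DifferentiableAt ℝ (v t) x := (hu2.differentiable (by norm_num)) x
  have hline := hcl.smooth_velocity.hasDerivAt_timeLine hS ht x
  -- the momentum equation at `(t, x)`
  have hm := hcl.momentum t ht x
  rw [timeDerivWithin_eq_deriv hS ht] at hm
  simp only [convect_apply, Pi.zero_apply, add_zero, one_smul] at hm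
  have h5 : deriv (fun s => v s x) t = (Δ (v t)) x - gradient (p t) x - fderiv ℝ (v t) x (v t x) := by
    rw [← hm]; abel
  have h4 : ∀ w : EuclideanSpace ℝ (Fin 3), fderiv ℝ (p t) x w = ⟪gradient (p t) x, w⟫ := fun w => by
    rw [gradient, InnerProductSpace.toDual_symm_apply]
  rw [(hasDerivAt_headField_time hq hline).deriv, fderiv_headField_apply hq hud, laplacian_headField hq hu2,
    hcl.divFree t ht x, h4, h5, ← real_inner_self_eq_norm_sq (v t x)]
  simp only [inner_sub_right, inner_add_right, inner_smul_right, real_inner_comm ((Δ (v t)) x) (v t x),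
    real_inner_comm (v t x) (gradient (p t) x), real_inner_comm x (gradient (p t) x)]
  ring

/-! ### Bounds on a window -/

/-- `a / r^k ≤ a / s^k` for `0 < s ≤ r`, `0 ≤ a`. [folklore] -/
theorem div_pow_le_div_pow {a r s : ℝ} (ha : 0 ≤ a) (hs : 0 < s) (hsr : s ≤ r) (k : ℕ) :
    a / r ^ k ≤ a / s ^ k :=
  div_le_div_of_nonneg_left ha (pow_pos hs k) (pow_le_pow_left₀ hs.le hsr k)

/-- `‖x‖ · a/(‖x‖+σ)^(k+1) ≤ a/(‖x‖+σ)^k` (`a ≥ 0`, `σ > 0`): one power of the weight absorbs `‖x‖`. [folklore] -/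
theorem norm_mul_div_pow_succ_le {a σ : ℝ} (ha : 0 ≤ a) (hσ : 0 < σ) (x : EuclideanSpace ℝ (Fin 3)) (k : ℕ) :
    ‖x‖ * (a / (‖x‖ + σ) ^ (k + 1)) ≤ a / (‖x‖ + σ) ^ k := by
  have hρ : 0 < ‖x‖ + σ := by positivity
  have hk : 0 < (‖x‖ + σ) ^ k := pow_pos hρ k
  rw [pow_succ, mul_div_assoc', div_le_div_iff₀ (by positivity) hk]
  have h1 : ‖x‖ * a ≤ (‖x‖ + σ) * a := mul_le_mul_of_nonneg_right (by linarith) ha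
  calc ‖x‖ * a * (‖x‖ + σ) ^ k ≤ (‖x‖ + σ) * a * (‖x‖ + σ) ^ k :=
        mul_le_mul_of_nonneg_right h1 hk.le
    _ = a * ((‖x‖ + σ) ^ k * (‖x‖ + σ)) := by ring

/-- **Window bounds for the head test field.**  On `(a,b) × EuclideanSpace ℝ (Fin 3)`, `−1 ≤ a < b < 0`, if `‖v‖ ≤ C/(‖x‖+√(−t))`,
`‖Dv‖ ≤ L/(‖x‖+√(−t))²`, `‖D²v‖ ≤ L/(‖x‖+√(−t))³` and `‖∂ₜv‖ ≤ L/(‖x‖+√(−t))³` for `t < 0`, then `q_E`, `Dq_E`, `Δq_E`,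
`∂ₜq_E` are bounded by one constant on the window (each weight `‖x‖` is absorbed by one power of
`‖x‖ + √(−t) ≥ √(−b)`). [folklore] -/
theorem headField_window_bounds {S : Set ℝ} {v : ℝ → EuclideanSpace ℝ (Fin 3) → EuclideanSpace ℝ (Fin 3)} {p : ℝ → EuclideanSpace ℝ (Fin 3) → ℝ}
    (hcl : IsClassicalNSSolutionOn S 1 0 v p) (hS : IsOpen S) {q : ℝ → EuclideanSpace ℝ (Fin 3) → ℝ}
    (hq : ∀ t x, q t x = (-t) / 2 * ‖v t x‖ ^ 2 + 1 / 2 * ⟪x, v t x⟫)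
    {C L a b : ℝ} (hC : 0 ≤ C) (hL : 0 ≤ L) (ha : -1 ≤ a) (hb : b < 0) (hab : Ioo a b ⊆ S)
    (h0 : ∀ t < (0 : ℝ), ∀ x : EuclideanSpace ℝ (Fin 3), ‖v t x‖ ≤ C / (‖x‖ + Real.sqrt (-t)))
    (h1 : ∀ t < (0 : ℝ), ∀ x : EuclideanSpace ℝ (Fin 3), ‖fderiv ℝ (v t) x‖ ≤ L / (‖x‖ + Real.sqrt (-t)) ^ 2)
    (h2 : ∀ t < (0 : ℝ), ∀ x : EuclideanSpace ℝ (Fin 3), ‖iteratedFDeriv ℝ 2 (v t) x‖ ≤ L / (‖x‖ + Real.sqrt (-t)) ^ 3)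
    (h3 : ∀ t < (0 : ℝ), ∀ x : EuclideanSpace ℝ (Fin 3), ‖deriv (fun s => v s x) t‖ ≤ L / (‖x‖ + Real.sqrt (-t)) ^ 3) :
    ∃ M : ℝ, ∀ t ∈ Ioo a b, ∀ x : EuclideanSpace ℝ (Fin 3), |q t x| ≤ M ∧ ‖fderiv ℝ (q t) x‖ ≤ M ∧
      |(Δ (q t)) x| ≤ M ∧ |timeDerivWithin (Ioo a b) q t x| ≤ M := by
  set σ : ℝ := Real.sqrt (-b) with hσ_def
  have hσ : 0 < σ := Real.sqrt_pos.2 (by linarith)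
  -- shorthand constants
  set cV : ℝ := C / σ with hcV
  set cD : ℝ := L / σ ^ 2 with hcD
  set cL : ℝ := L / σ ^ 3 with hcL
  have hcV0 : 0 ≤ cV := by positivity
  have hcD0 : 0 ≤ cD := by positivity
  have hcL0 : 0 ≤ cL := by positivity
  set M₀ : ℝ := 1 / 2 * cV ^ 2 + 1 / 2 * C with hM₀
  set M₁ : ℝ := cV * cD + 1 / 2 * cV + 1 / 2 * (L / σ) with hM₁
  set M₂ : ℝ := 3 * cL * cV + 3 * cD ^ 2 + 1 / 2 * (3 * cD) with hM₂
  set M₃ : ℝ := 1 / 2 * cV ^ 2 + cV * cL + 1 / 2 * cD with hM₃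
  refine ⟨max (max M₀ M₁) (max M₂ M₃), fun t ht x => ?_⟩
  have ht0 : t < 0 := ht.2.trans hb
  have htS : t ∈ S := hab ht
  have hst : σ ≤ Real.sqrt (-t) := Real.sqrt_le_sqrt (by linarith [ht.2])
  have hst0 : 0 < Real.sqrt (-t) := lt_of_lt_of_le hσ hst
  have ht1 : -t ≤ 1 := by linarith [ht.1]
  have hnt : 0 ≤ -t := by linarith
  set ρ : ℝ := ‖x‖ + Real.sqrt (-t) with hρ
  have hσρ : σ ≤ ρ := by rw [hρ]; linarith [norm_nonneg x]
  have hρ0 : 0 < ρ := lt_of_lt_of_le hσ hσρ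
  have hu2 : ContDiff ℝ 2 (v t) := (hcl.contDiff_velocity htS).of_le (by norm_cast)
  have hud : DifferentiableAt ℝ (v t) x := (hu2.differentiable (by norm_num)) x
  -- the basic quantities at `(t, x)` and their bounds
  set V : EuclideanSpace ℝ (Fin 3) := v t x with hV
  set A : EuclideanSpace ℝ (Fin 3) := deriv (fun s => v s x) t with hA
  set Dv : EuclideanSpace ℝ (Fin 3) →L[ℝ] EuclideanSpace ℝ (Fin 3) := fderiv ℝ (v t) x with hDv
  set Lv : EuclideanSpace ℝ (Fin 3) := (Δ (v t)) x with hLv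
  have bV : ‖V‖ ≤ cV := (h0 t ht0 x).trans (div_le_div_of_nonneg_left hC hσ hσρ)
  have bxV : ‖x‖ * ‖V‖ ≤ C := by
    refine (mul_le_mul_of_nonneg_left (h0 t ht0 x) (norm_nonneg x)).trans ?_
    have h := norm_mul_div_pow_succ_le hC hst0 x 0
    rwa [zero_add, pow_one, pow_zero, div_one] at h
  have bDv : ‖Dv‖ ≤ cD := (h1 t ht0 x).trans (div_pow_le_div_pow hL hσ hσρ 2)
  have bxDv : ‖x‖ * ‖Dv‖ ≤ L / σ := by
    refine (mul_le_mul_of_nonneg_left (h1 t ht0 x) (norm_nonneg x)).trans ?_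
    refine (norm_mul_div_pow_succ_le hL hst0 x 1).trans ?_
    rw [pow_one]; exact div_le_div_of_nonneg_left hL hσ hσρ
  have bD2 : ‖iteratedFDeriv ℝ 2 (v t) x‖ ≤ cL := (h2 t ht0 x).trans (div_pow_le_div_pow hL hσ hσρ 3)
  have bLv : ‖Lv‖ ≤ 3 * cL := (norm_laplacian_le_three_mul (v t) x).trans (by linarith)
  have bxLv : ‖x‖ * ‖Lv‖ ≤ 3 * cD := by
    have e1 : ‖x‖ * ‖Lv‖ ≤ ‖x‖ * (3 * ‖iteratedFDeriv ℝ 2 (v t) x‖) :=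
      mul_le_mul_of_nonneg_left (norm_laplacian_le_three_mul (v t) x) (norm_nonneg x)
    have e2 : ‖x‖ * ‖iteratedFDeriv ℝ 2 (v t) x‖ ≤ cD :=
      (mul_le_mul_of_nonneg_left (h2 t ht0 x) (norm_nonneg x)).trans
        ((norm_mul_div_pow_succ_le hL hst0 x 2).trans (div_pow_le_div_pow hL hσ hσρ 2))
    linarith
  have bA : ‖A‖ ≤ cL := (h3 t ht0 x).trans (div_pow_le_div_pow hL hσ hσρ 3)
  have bxA : ‖x‖ * ‖A‖ ≤ cD :=
    (mul_le_mul_of_nonneg_left (h3 t ht0 x) (norm_nonneg x)).trans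
      ((norm_mul_div_pow_succ_le hL hst0 x 2).trans (div_pow_le_div_pow hL hσ hσρ 2))
  have bF : frobeniusNormSq Dv ≤ 3 * cD ^ 2 := by
    have h := frobeniusNormSq_le_three_mul Dv
    have h' : ‖Dv‖ ^ 2 ≤ cD ^ 2 := pow_le_pow_left₀ (norm_nonneg _) bDv 2
    linarith
  -- elementary products
  have pVD : ∀ w : EuclideanSpace ℝ (Fin 3), |⟪V, Dv w⟫| ≤ cV * cD * ‖w‖ := fun w =>
    calc |⟪V, Dv w⟫| ≤ ‖V‖ * ‖Dv w‖ := abs_real_inner_le_norm _ _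
      _ ≤ ‖V‖ * (‖Dv‖ * ‖w‖) := mul_le_mul_of_nonneg_left (Dv.le_opNorm w) (norm_nonneg _)
      _ = (‖V‖ * ‖Dv‖) * ‖w‖ := by ring
      _ ≤ (cV * cD) * ‖w‖ :=
          mul_le_mul_of_nonneg_right (mul_le_mul bV bDv (norm_nonneg _) hcV0) (norm_nonneg _)
  have pwV : ∀ w : EuclideanSpace ℝ (Fin 3), |⟪w, V⟫| ≤ cV * ‖w‖ := fun w => by
    rw [real_inner_comm]
    exact (abs_real_inner_le_norm V w).trans (mul_le_mul_of_nonneg_right bV (norm_nonneg _))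
  have pxD : ∀ w : EuclideanSpace ℝ (Fin 3), |⟪x, Dv w⟫| ≤ (L / σ) * ‖w‖ := fun w =>
    calc |⟪x, Dv w⟫| ≤ ‖x‖ * ‖Dv w‖ := abs_real_inner_le_norm _ _
      _ ≤ ‖x‖ * (‖Dv‖ * ‖w‖) := mul_le_mul_of_nonneg_left (Dv.le_opNorm w) (norm_nonneg _)
      _ = (‖x‖ * ‖Dv‖) * ‖w‖ := by ring
      _ ≤ (L / σ) * ‖w‖ := mul_le_mul_of_nonneg_right bxDv (norm_nonneg _)
  have pLV : |⟪Lv, V⟫| ≤ 3 * cL * cV :=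
    (abs_real_inner_le_norm _ _).trans (mul_le_mul bLv bV (norm_nonneg _) (by positivity))
  have pxL : |⟪x, Lv⟫| ≤ 3 * cD := (abs_real_inner_le_norm _ _).trans bxLv
  have pVA : |⟪V, A⟫| ≤ cV * cL := (abs_real_inner_le_norm _ _).trans (mul_le_mul bV bA (norm_nonneg _) hcV0)
  have pxA : |⟪x, A⟫| ≤ cD := (abs_real_inner_le_norm _ _).trans bxA
  have pVV : ‖V‖ ^ 2 ≤ cV ^ 2 := pow_le_pow_left₀ (norm_nonneg _) bV 2
  refine ⟨?_, ?_, ?_, ?_⟩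
  · -- `|q_E|`
    refine le_trans ?_ ((le_max_left _ _).trans (le_max_left _ _))
    rw [hq]
    have e1 : |(-t) / 2 * ‖V‖ ^ 2| ≤ 1 / 2 * cV ^ 2 := by
      rw [abs_of_nonneg (mul_nonneg (by linarith) (sq_nonneg _))]
      nlinarith [sq_nonneg ‖V‖]
    have e2 : |1 / 2 * ⟪x, V⟫| ≤ 1 / 2 * C := by
      rw [abs_mul, abs_of_pos (by norm_num : (0 : ℝ) < 1 / 2)]
      exact mul_le_mul_of_nonneg_left ((abs_real_inner_le_norm _ _).trans bxV) (by norm_num)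
    exact (abs_add_le _ _).trans (add_le_add e1 e2)
  · -- `‖Dq_E‖`
    refine le_trans ?_ ((le_max_right _ _).trans (le_max_left _ _))
    have hM₁0 : 0 ≤ M₁ := by positivity
    refine ContinuousLinearMap.opNorm_le_bound _ hM₁0 fun w => ?_
    rw [fderiv_headField_apply hq hud w, Real.norm_eq_abs]
    have e1 : |(-t) * ⟪V, Dv w⟫| ≤ cV * cD * ‖w‖ := by
      rw [abs_mul, abs_of_nonneg hnt]
      calc (-t) * |⟪V, Dv w⟫| ≤ 1 * (cV * cD * ‖w‖) := mul_le_mul ht1 (pVD w) (abs_nonneg _) zero_le_one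
        _ = cV * cD * ‖w‖ := one_mul _
    have e2 : |1 / 2 * ⟪w, V⟫| ≤ 1 / 2 * (cV * ‖w‖) := by
      rw [abs_mul, abs_of_pos (by norm_num : (0 : ℝ) < 1 / 2)]
      exact mul_le_mul_of_nonneg_left (pwV w) (by norm_num)
    have e3 : |1 / 2 * ⟪x, Dv w⟫| ≤ 1 / 2 * ((L / σ) * ‖w‖) := by
      rw [abs_mul, abs_of_pos (by norm_num : (0 : ℝ) < 1 / 2)]
      exact mul_le_mul_of_nonneg_left (pxD w) (by norm_num)
    calc |(-t) * ⟪V, Dv w⟫ + 1 / 2 * ⟪w, V⟫ + 1 / 2 * ⟪x, Dv w⟫|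
        ≤ |(-t) * ⟪V, Dv w⟫ + 1 / 2 * ⟪w, V⟫| + |1 / 2 * ⟪x, Dv w⟫| := abs_add_le _ _
      _ ≤ (|(-t) * ⟪V, Dv w⟫| + |1 / 2 * ⟪w, V⟫|) + |1 / 2 * ⟪x, Dv w⟫| := by
          gcongr; exact abs_add_le _ _
      _ ≤ (cV * cD * ‖w‖ + 1 / 2 * (cV * ‖w‖)) + 1 / 2 * ((L / σ) * ‖w‖) := by gcongr
      _ = M₁ * ‖w‖ := by rw [hM₁]; ring
  · -- `|Δq_E|`
    refine le_trans ?_ ((le_max_left _ _).trans (le_max_right _ _))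
    rw [laplacian_headField hq hu2 x, hcl.divFree t htS x, add_zero]
    have e1 : |(-t) * (⟪Lv, V⟫ + frobeniusNormSq Dv)| ≤ 3 * cL * cV + 3 * cD ^ 2 := by
      rw [abs_mul, abs_of_nonneg hnt]
      have i : |⟪Lv, V⟫ + frobeniusNormSq Dv| ≤ 3 * cL * cV + 3 * cD ^ 2 := by
        refine (abs_add_le _ _).trans (add_le_add pLV ?_)
        rw [abs_of_nonneg (frobeniusNormSq_nonneg _)]; exact bF
      calc (-t) * |⟪Lv, V⟫ + frobeniusNormSq Dv| ≤ 1 * (3 * cL * cV + 3 * cD ^ 2) :=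
            mul_le_mul ht1 i (abs_nonneg _) zero_le_one
        _ = 3 * cL * cV + 3 * cD ^ 2 := one_mul _
    have e2 : |1 / 2 * ⟪x, Lv⟫| ≤ 1 / 2 * (3 * cD) := by
      rw [abs_mul, abs_of_pos (by norm_num : (0 : ℝ) < 1 / 2)]
      exact mul_le_mul_of_nonneg_left pxL (by norm_num)
    exact (abs_add_le _ _).trans (by rw [hM₂]; linarith)
  · -- `|∂ₜq_E|`
    refine le_trans ?_ ((le_max_right _ _).trans (le_max_right _ _))
    have hline := hcl.smooth_velocity.hasDerivAt_timeLine hS htS x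
    rw [timeDerivWithin_eq_deriv isOpen_Ioo ht, (hasDerivAt_headField_time hq hline).deriv]
    have e1 : |-(1 / 2) * ‖v t x‖ ^ 2| ≤ 1 / 2 * cV ^ 2 := by
      rw [abs_mul, abs_neg, abs_of_pos (by norm_num : (0 : ℝ) < 1 / 2), abs_of_nonneg (sq_nonneg _)]
      exact mul_le_mul_of_nonneg_left pVV (by norm_num)
    have e2 : |(-t) * ⟪V, A⟫| ≤ cV * cL := by
      rw [abs_mul, abs_of_nonneg hnt]
      calc (-t) * |⟪V, A⟫| ≤ 1 * (cV * cL) := mul_le_mul ht1 pVA (abs_nonneg _) zero_le_one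
        _ = cV * cL := one_mul _
    have e3 : |1 / 2 * ⟪x, A⟫| ≤ 1 / 2 * cD := by
      rw [abs_mul, abs_of_pos (by norm_num : (0 : ℝ) < 1 / 2)]
      exact mul_le_mul_of_nonneg_left pxA (by norm_num)
    calc |-(1 / 2) * ‖v t x‖ ^ 2 + (-t) * ⟪V, A⟫ + 1 / 2 * ⟪x, A⟫|
        ≤ |-(1 / 2) * ‖v t x‖ ^ 2 + (-t) * ⟪V, A⟫| + |1 / 2 * ⟪x, A⟫| := abs_add_le _ _
      _ ≤ (|-(1 / 2) * ‖v t x‖ ^ 2| + |(-t) * ⟪V, A⟫|) + |1 / 2 * ⟪x, A⟫| := by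
          gcongr; exact abs_add_le _ _
      _ ≤ (1 / 2 * cV ^ 2 + cV * cL) + 1 / 2 * cD := by gcongr
      _ = M₃ := by rw [hM₃]

/-! ### The global bound on the head test field -/

/-- **`|q_E(t,x)| ≤ ½C² + ½C`** for all `t < 0`, `x`, under the space–time Type-I bound `‖v(t,x)‖ ≤ C/(‖x‖+√(−t))`:
`(−t)‖v‖² ≤ C²` and `‖x‖‖v‖ ≤ C`. [folklore] -/
theorem abs_headField_le {C : ℝ} {v : ℝ → EuclideanSpace ℝ (Fin 3) → EuclideanSpace ℝ (Fin 3)} (hdec : HasTypeIDecay C v)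
    (hC : 0 ≤ C) {q : ℝ → EuclideanSpace ℝ (Fin 3) → ℝ}
    (hq : ∀ t x, q t x = (-t) / 2 * ‖v t x‖ ^ 2 + 1 / 2 * ⟪x, v t x⟫) {t : ℝ} (ht : t < 0)
    (x : EuclideanSpace ℝ (Fin 3)) : |q t x| ≤ 1 / 2 * C ^ 2 + 1 / 2 * C := by
  have hst0 : 0 < Real.sqrt (-t) := Real.sqrt_pos.2 (by linarith)
  have hρ0 : 0 < ‖x‖ + Real.sqrt (-t) := by positivity
  have hnt : 0 ≤ -t := by linarith
  have hv := hdec t ht x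
  -- `√(−t)‖v‖ ≤ C` and `‖x‖‖v‖ ≤ C`
  have hs : Real.sqrt (-t) * ‖v t x‖ ≤ C := by
    refine (mul_le_mul_of_nonneg_left hv hst0.le).trans ?_
    rw [mul_div_assoc', div_le_iff₀ hρ0]
    nlinarith [norm_nonneg x, mul_nonneg hC (norm_nonneg x)]
  have h2 : ‖x‖ * ‖v t x‖ ≤ C := by
    refine (mul_le_mul_of_nonneg_left hv (norm_nonneg _)).trans ?_
    rw [mul_div_assoc', div_le_iff₀ hρ0]
    nlinarith [norm_nonneg x, mul_nonneg hC hst0.le]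
  have h1 : (-t) * ‖v t x‖ ^ 2 ≤ C ^ 2 := by
    have hs0 : 0 ≤ Real.sqrt (-t) * ‖v t x‖ := by positivity
    calc (-t) * ‖v t x‖ ^ 2 = (Real.sqrt (-t) * ‖v t x‖) ^ 2 := by
          rw [mul_pow, Real.sq_sqrt hnt]
      _ ≤ C ^ 2 := pow_le_pow_left₀ hs0 hs 2
  rw [hq]
  have e1 : |(-t) / 2 * ‖v t x‖ ^ 2| ≤ 1 / 2 * C ^ 2 := by
    rw [abs_of_nonneg (mul_nonneg (by linarith) (sq_nonneg _))]
    linarith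
  have e2 : |1 / 2 * ⟪x, v t x⟫| ≤ 1 / 2 * C := by
    rw [abs_mul, abs_of_pos (by norm_num : (0 : ℝ) < 1 / 2)]
    exact mul_le_mul_of_nonneg_left ((abs_real_inner_le_norm _ _).trans h2) (by norm_num)
  exact (abs_add_le _ _).trans (add_le_add e1 e2)

end Summit.NavierStokesRegularity.NavierStokesRegularity.Theorems.LocalPressureProfileDoorMonotonePressureProfileRigiditySmallSliceHead

end
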